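import Literature.MathematicalPhysics.QuantumFieldTheory.BalabanImbrieJaffe1984to88.BIJ88Sect5StatementsPart4

/-!
# `BalabanImbrieJaffe1984to88.BIJ88Ineq297` — T. Bałaban, J. Imbrie, A. Jaffe, *Effective action and cluster properties of
the abelian Higgs model*, Commun. Math. Phys. **114** (1988) 257–315 [BalabanImbrieJaffe1988], §5.9 *Bounds on Fluctuation
and Block Fields*, p. 297: the bracketed inequality *"(8λ)^{−1/2}(L^kε)^{(d−2)/2} + p(e_k)(L^kε)^{−1} ≦ cp(e_k)λ_k^{−1/4}"* used to
replace `χ_{k,Λ₀^{(k−1)′}}` by `χ_{k,Λ₀^{(k−1)′}∩Λ₁^{(k)c}}` — PROVED with an explicit constant, and its use: the RING restriction of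
(5.9.2) in the regime `(L^kε)^d ≧ λ` implies a BALL restriction of the uniform shape `cp(e_k)λ_k^{−1/4}`

statement-level skeleton of published theorems with citation tags; proofs where landed; nothing here is a claim about the Yang–Mills mass gap

PDF held: `paper:balaban1988-cmp114-bij-abelian-higgs-effective-action` (journal page = PDF page + 256).  Render read this
session: p. 297 = PDF 41 (`pages/original-p041-x2.png` of the p02 seat, G4 decode of the scan, read as image).

**What the paper prints (p. 297, verbatim).**  *"We note that the restrictions implied by χ_{Λ₀^{(k)}} are stronger than the
corresponding restrictions in χ_{k,Λ₀^{(k−1)′}} in Λ₀^{(k)}. [When (L^kε)^d ≧ λ, we use the inequality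
(8λ)^{−1/2}(L^kε)^{(d−2)/2} + p(e_k)(L^kε)^{−1} ≦ cp(e_k)λ_k^{−1/4}.] Thus we can replace χ_{k,Λ₀^{(k−1)′}} with χ_{k,Λ₀^{(k−1)′}∩Λ₁^{(k)c}}
without changing anything."*  Context: (5.9.2) p. 296 *"|ψ(y)| ≦ cp(e_k)λ_k^{−1/4}, (L^kε)^d < λ, ||ψ(y)| − (8λ)^{−1/2}(L^kε)^{(d−2)/2}|
≦ cp(e_k)(L^kε)^{−1}, (L^kε)^d ≧ λ"* (r16's `BIJ88Sect5StatementsPart4.Restr592`), `λ_k = (L^kε)^{4−d}λ` ((2.2)/(3.9), r16's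
`BIJ88Sect5Statements.lamK`).

**What is reproduced here (kernel-checked, zero `sorry`, no definitions, no named facts).**  With `s = L^kε`, `λ_k = s^{4−d}λ`:
* **`ineq297`** — for `0 < s ≤ 1`, `0 < λ ≤ s^d`, `p ≥ 1`, `d ≤ 4`: `(8λ)^{−1/2}s^{(d−2)/2} + p s^{−1} ≤ c·p·λ_k^{−1/4}` with the EXPLICIT
  `c = 1 + 8^{−1/2}λ^{−1/4}` (mechanism: `p s^{−1} ≤ pλ^{−1/4}s^{(d−4)/4}` is exactly `λ ≤ s^d`; `s^{(d−2)/2} ≤ s^{(d−4)/4}` for `s ≤ 1`).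
* **`norm_le_ball_of_ring`** — the use: the ring condition `||ψ(y)| − (8λ)^{−1/2}s^{(d−2)/2}| ≤ c₀p s^{−1}` (regime `λ ≤ s^d`) implies
  the ball condition `|ψ(y)| ≤ max(1,c₀)·c·p·λ_k^{−1/4}`.
* **`restr592_ball`** — hence r16's typed (5.9.2) `Restr592 c₀ p λ_k λ s d Λ₀′ ψ` (both regimes, `λ_k = lamK λ s d`) gives the uniform
  ball restriction `|ψ(y)| ≤ max(1,c₀)·c·p·λ_k^{−1/4}` on `Λ₀′` — the shape of the level-`k` restriction (4.5) that
  `χ_{k,Λ₀^{(k−1)′}}` imposes, which is why it can be dropped on `Λ₁^{(k)}` *"without changing anything"*.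

**Readings (declared).**  (i) the generic `c` of the bracket is made explicit and depends on `λ` (`c = 1 + (8λ)^{−1/2}λ^{1/4}`, i.e.
`1 + 8^{−1/2}λ^{−1/4}`); the paper's constants are uniform in `k`, `e_k`, not in the fixed coupling `λ`.  (ii) `s = L^kε ≤ 1`
(`k ≤ K`, `L^Kε = 1`) and `p = p(e_k) ≥ 1` are the standing ranges; `d ≤ 4` (the paper: `d = 2, 3`).  (iii) the implication
between characteristic functions themselves (supports of `χ`'s) is not modelled — only the inequality between their radii.

**What is NOT claimed.**  (5.9.1)–(5.9.5) (r16's leaves; (5.9.3)–(5.9.5) proved by p36 in `BIJ88Ineq593Proof`/`594Proof`/`595Proof`),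
the insertion of `χ_{k+1,Λ₀^{(k)′}}`, `χ′_{Λ₇^{(k)}}` (`chiNext`, `chiPrime7`), the density (5.9.6); anything of B1–B16.  NOT summit
progress; NOT continuum; NOT Clay.  Imports: r16's `BIJ88Sect5StatementsPart4`; no Summits import; sub-namespace `…BIJ88Ineq297`;
modifies nothing.  Cell `lit-balaban` Phase 2, seat p02 gen 4; row C2.Eq5.9.4-5.9.5 (owner r16), the p. 297 bracket «uses
(8λ)^{−1/2}(L^kε)^{(d−2)/2} + p(e_k)(L^kε)^{−1} ≤ cp(e_k)λ_k^{−1/4}» → proved.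
-/

namespace Literature.MathematicalPhysics.QuantumFieldTheory.BalabanImbrieJaffe1984to88.BIJ88Ineq297

open BIJ88Sect5Statements (lamK)

/-- `λ_k^{−1/4} = λ^{−1/4}·s^{(d−4)/4}` for `λ_k = s^{4−d}λ`, `s > 0`, `λ ≥ 0`. [cite: BalabanImbrieJaffe1988, (2.2) p.260] -/
theorem lamK_rpow_neg_quarter {lam s : ℝ} (hlam : 0 ≤ lam) (hs : 0 < s) (d : ℕ) :
    (lamK lam s d) ^ (-(1 / 4 : ℝ)) = lam ^ (-(1 / 4 : ℝ)) * s ^ (((d : ℝ) - 4) / 4) := by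
  have hz : (s ^ ((4 : ℤ) - d) : ℝ) = s ^ ((4 : ℝ) - d) := by
    rw [← Real.rpow_intCast]
    push_cast
    ring_nf
  rw [lamK, hz, Real.mul_rpow (Real.rpow_nonneg hs.le _) hlam, ← Real.rpow_mul hs.le, mul_comm]
  congr 1
  ring_nf

/-- **p. 297, the bracket** [PDF 41], verbatim: *"When (L^kε)^d ≧ λ, we use the inequality (8λ)^{−1/2}(L^kε)^{(d−2)/2} + p(e_k)(L^kε)^{−1}
≦ cp(e_k)λ_k^{−1/4}."* — PROVED with `s = L^kε ∈ (0,1]`, `0 < λ ≤ s^d`, `p(e_k) ≥ 1`, `d ≤ 4`, `λ_k = s^{4−d}λ`, and the explicit constant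
`c = 1 + 8^{−1/2}λ^{−1/4}`. [cite: BalabanImbrieJaffe1988, (5.9.5) p.297] -/
theorem ineq297 {lam s pek : ℝ} {d : ℕ} (hlam : 0 < lam) (hs : 0 < s) (hs1 : s ≤ 1) (hd : d ≤ 4) (hsd : lam ≤ s ^ d)
    (hp : 1 ≤ pek) :
    (8 * lam) ^ (-(1 / 2 : ℝ)) * s ^ (((d : ℝ) - 2) / 2) + pek * s⁻¹
      ≤ (1 + 8 ^ (-(1 / 2 : ℝ)) * lam ^ (-(1 / 4 : ℝ))) * pek * (lamK lam s d) ^ (-(1 / 4 : ℝ)) := by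
  rw [lamK_rpow_neg_quarter hlam.le hs d]
  set T : ℝ := s ^ (((d : ℝ) - 4) / 4) with hT
  set Λ : ℝ := lam ^ (-(1 / 4 : ℝ)) with hΛ
  have hT0 : 0 < T := Real.rpow_pos_of_pos hs _
  have hΛ0 : 0 < Λ := Real.rpow_pos_of_pos hlam _
  have hp0 : 0 < pek := lt_of_lt_of_le one_pos hp
  -- second term: pek·s⁻¹ ≤ pek·Λ·T  ⟸  s⁻¹ ≤ Λ·T, i.e. λ^{1/4} ≤ s^{d/4}
  have h2 : s⁻¹ ≤ Λ * T := by
    have hsplit : T = s ^ ((d : ℝ) / 4) * s⁻¹ := by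
      rw [hT, ← Real.rpow_neg_one, ← Real.rpow_add hs]
      congr 1
      ring
    have hquart : lam ^ (1 / 4 : ℝ) ≤ s ^ ((d : ℝ) / 4) := by
      have h := Real.rpow_le_rpow hlam.le hsd (by norm_num : (0 : ℝ) ≤ 1 / 4)
      rw [← Real.rpow_natCast, ← Real.rpow_mul hs.le] at h
      convert h using 2
      ring
    have hΛinv : Λ = (lam ^ (1 / 4 : ℝ))⁻¹ := by rw [hΛ, Real.rpow_neg hlam.le]
    rw [hsplit, ← mul_assoc, hΛinv]
    have hl4 : 0 < lam ^ (1 / 4 : ℝ) := Real.rpow_pos_of_pos hlam _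
    have hkey : 1 ≤ (lam ^ (1 / 4 : ℝ))⁻¹ * s ^ ((d : ℝ) / 4) := by
      rw [inv_mul_eq_div, one_le_div hl4]
      exact hquart
    calc s⁻¹ = 1 * s⁻¹ := (one_mul _).symm
      _ ≤ (lam ^ (1 / 4 : ℝ))⁻¹ * s ^ ((d : ℝ) / 4) * s⁻¹ :=
          mul_le_mul_of_nonneg_right hkey (inv_nonneg.2 hs.le)
  -- first term: (8λ)^{-1/2} s^{(d-2)/2} ≤ 8^{-1/2} λ^{-1/4}·pek·Λ·T
  have h1 : (8 * lam) ^ (-(1 / 2 : ℝ)) * s ^ (((d : ℝ) - 2) / 2)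
      ≤ 8 ^ (-(1 / 2 : ℝ)) * lam ^ (-(1 / 4 : ℝ)) * pek * (Λ * T) := by
    have hexp : s ^ (((d : ℝ) - 2) / 2) ≤ T := by
      have hdr : (d : ℝ) ≤ 4 := by exact_mod_cast hd
      exact Real.rpow_le_rpow_of_exponent_ge hs hs1 (by linarith)
    have h8 : (8 * lam) ^ (-(1 / 2 : ℝ)) = 8 ^ (-(1 / 2 : ℝ)) * (Λ * Λ) := by
      rw [Real.mul_rpow (by norm_num) hlam.le, hΛ, ← Real.rpow_add hlam]
      norm_num
    rw [h8]
    have h80 : 0 ≤ (8 : ℝ) ^ (-(1 / 2 : ℝ)) := Real.rpow_nonneg (by norm_num) _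
    have hTle : s ^ (((d : ℝ) - 2) / 2) ≤ pek * T := by
      calc s ^ (((d : ℝ) - 2) / 2) ≤ T := hexp
        _ = 1 * T := (one_mul _).symm
        _ ≤ pek * T := mul_le_mul_of_nonneg_right hp hT0.le
    calc 8 ^ (-(1 / 2 : ℝ)) * (Λ * Λ) * s ^ (((d : ℝ) - 2) / 2)
        ≤ 8 ^ (-(1 / 2 : ℝ)) * (Λ * Λ) * (pek * T) :=
          mul_le_mul_of_nonneg_left hTle (mul_nonneg h80 (mul_nonneg hΛ0.le hΛ0.le))
      _ = 8 ^ (-(1 / 2 : ℝ)) * lam ^ (-(1 / 4 : ℝ)) * pek * (Λ * T) := by rw [hΛ]; ring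
  have h2' : pek * s⁻¹ ≤ 1 * pek * (Λ * T) := by
    rw [one_mul]
    exact mul_le_mul_of_nonneg_left h2 hp0.le
  calc (8 * lam) ^ (-(1 / 2 : ℝ)) * s ^ (((d : ℝ) - 2) / 2) + pek * s⁻¹
      ≤ 8 ^ (-(1 / 2 : ℝ)) * lam ^ (-(1 / 4 : ℝ)) * pek * (Λ * T) + 1 * pek * (Λ * T) := add_le_add h1 h2'
    _ = (1 + 8 ^ (-(1 / 2 : ℝ)) * lam ^ (-(1 / 4 : ℝ))) * pek * (Λ * T) := by ring

/-- **The use of the bracket** (p. 297): in the regime `λ ≤ (L^kε)^d` the RING restriction of (5.9.2),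
`||ψ(y)| − (8λ)^{−1/2}(L^kε)^{(d−2)/2}| ≤ c₀p(e_k)(L^kε)^{−1}`, implies the BALL restriction `|ψ(y)| ≤ max(1,c₀)·c·p(e_k)·λ_k^{−1/4}`
(`c` of `ineq297`). [cite: BalabanImbrieJaffe1988, (5.9.5) p.297] -/
theorem norm_le_ball_of_ring {lam s pek c₀ r : ℝ} {d : ℕ} (hlam : 0 < lam) (hs : 0 < s) (hs1 : s ≤ 1) (hd : d ≤ 4)
    (hsd : lam ≤ s ^ d) (hp : 1 ≤ pek)
    (hring : |r - (8 * lam) ^ (-(1 / 2 : ℝ)) * s ^ (((d : ℝ) - 2) / 2)| ≤ c₀ * pek * s⁻¹) :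
    r ≤ max 1 c₀ * ((1 + 8 ^ (-(1 / 2 : ℝ)) * lam ^ (-(1 / 4 : ℝ))) * pek * (lamK lam s d) ^ (-(1 / 4 : ℝ))) := by
  have hρ0 : 0 ≤ (8 * lam) ^ (-(1 / 2 : ℝ)) * s ^ (((d : ℝ) - 2) / 2) :=
    mul_nonneg (Real.rpow_nonneg (by linarith) _) (Real.rpow_nonneg hs.le _)
  have hps : 0 ≤ pek * s⁻¹ := mul_nonneg (by linarith) (inv_nonneg.2 hs.le)
  have hstep : r ≤ (8 * lam) ^ (-(1 / 2 : ℝ)) * s ^ (((d : ℝ) - 2) / 2) + c₀ * pek * s⁻¹ := by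
    have := (abs_sub_le_iff.1 hring).1
    linarith
  have hmax : (8 * lam) ^ (-(1 / 2 : ℝ)) * s ^ (((d : ℝ) - 2) / 2) + c₀ * pek * s⁻¹
      ≤ max 1 c₀ * ((8 * lam) ^ (-(1 / 2 : ℝ)) * s ^ (((d : ℝ) - 2) / 2) + pek * s⁻¹) := by
    rw [mul_add]
    refine add_le_add ?_ ?_
    · calc _ = 1 * ((8 * lam) ^ (-(1 / 2 : ℝ)) * s ^ (((d : ℝ) - 2) / 2)) := (one_mul _).symm
        _ ≤ _ := mul_le_mul_of_nonneg_right (le_max_left 1 c₀) hρ0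
    · rw [mul_assoc]
      exact mul_le_mul_of_nonneg_right (le_max_right 1 c₀) hps
  exact hstep.trans (hmax.trans
    (mul_le_mul_of_nonneg_left (ineq297 hlam hs hs1 hd hsd hp) (le_trans zero_le_one (le_max_left 1 c₀))))

variable {P : Balaban1983to89.Params} {j : ℕ}

/-- **Consequently** (p. 297 *"the restrictions implied by χ_{Λ₀^{(k)}} are stronger than the corresponding restrictions in
χ_{k,Λ₀^{(k−1)′}}"*, the bracket handling the regime `(L^kε)^d ≧ λ`): r16's typed (5.9.2) `Restr592 c₀ p(e_k) λ_k λ (L^kε) d Λ₀′ ψ`,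
in EITHER regime, yields the uniform ball restriction `|ψ(y)| ≤ max(1,c₀)·c·p(e_k)·λ_k^{−1/4}` on `Λ₀′` (with `λ_k = lamK λ (L^kε) d`).
[cite: BalabanImbrieJaffe1988, (5.9.2) p.296] -/
theorem restr592_ball {c₀ pek lam s : ℝ} {d : ℕ} {Λ0' : Finset (Balaban1983to89.Site P j)}
    {ψ : Balaban1983to89.Site P j → ℂ} (hlam : 0 < lam) (hs : 0 < s) (hs1 : s ≤ 1) (hd : d ≤ 4) (hp : 1 ≤ pek)
    (h : BIJ88Sect5StatementsPart4.Restr592 c₀ pek (lamK lam s d) lam s d Λ0' ψ) :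
    ∀ y ∈ Λ0', ‖ψ y‖ ≤ max 1 c₀ * ((1 + 8 ^ (-(1 / 2 : ℝ)) * lam ^ (-(1 / 4 : ℝ))) * pek * (lamK lam s d) ^ (-(1 / 4 : ℝ))) := by
  intro y hy
  rcases lt_or_ge (s ^ d) lam with hlt | hge
  · -- regime (L^kε)^d < λ: the ball restriction is printed directly (with c₀ ≤ max 1 c₀, 1 ≤ c)
    have hball := h.1 hlt y hy
    have hK0 : 0 ≤ pek * (lamK lam s d) ^ (-(1 / 4 : ℝ)) := by
      refine mul_nonneg (by linarith) (Real.rpow_nonneg ?_ _)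
      exact mul_nonneg (zpow_nonneg hs.le _) hlam.le
    have hc1 : (1 : ℝ) ≤ 1 + 8 ^ (-(1 / 2 : ℝ)) * lam ^ (-(1 / 4 : ℝ)) :=
      le_add_of_nonneg_right (mul_nonneg (Real.rpow_nonneg (by norm_num) _) (Real.rpow_nonneg hlam.le _))
    calc ‖ψ y‖ ≤ c₀ * pek * (lamK lam s d) ^ (-(1 / 4 : ℝ)) := hball
      _ = c₀ * 1 * (pek * (lamK lam s d) ^ (-(1 / 4 : ℝ))) := by ring
      _ ≤ max 1 c₀ * (1 + 8 ^ (-(1 / 2 : ℝ)) * lam ^ (-(1 / 4 : ℝ))) * (pek * (lamK lam s d) ^ (-(1 / 4 : ℝ))) := by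
          refine mul_le_mul_of_nonneg_right ?_ hK0
          exact mul_le_mul (le_max_right 1 c₀) hc1 zero_le_one (le_trans zero_le_one (le_max_left 1 c₀))
      _ = _ := by ring
  · exact norm_le_ball_of_ring hlam hs hs1 hd hge hp (h.2 hge y hy)

end Literature.MathematicalPhysics.QuantumFieldTheory.BalabanImbrieJaffe1984to88.BIJ88Ineq297
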